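import Literature.MathematicalPhysics.QuantumFieldTheory.Balaban1983to89.B8Thm2TorusServerP2
import Literature.MathematicalPhysics.QuantumFieldTheory.Balaban1983to89.B8Prop5StepUniq

/-!
# `Balaban1983to89.B8Thm2TorusServerP3` — [Balaban1985RegularSpaces] Prop. 5 (p. 94) on `T_η`: route P's THREE Proposition-5 sockets
# `SockP5Step`, `SockP5Base`, `SockP5Uniq` of `B8Thm2TorusSupplier.Thm2TorusSockets … G` for ONE periodic `G`-valued background, with print's
# «exactly one λ» DISCHARGED (no displayed `hUq`): from the letters at `U₀` (all truncations), the `τ`-laws, the b9 socket, the J-SU group data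
# and explicit windows (sub-row «G-B8-T2S», route P, layer L4 §2b–§3a with the uniqueness step served by `B8Prop5StepUniq`)

statement-level skeleton of published theorems with citation tags; proofs where landed; nothing here is a claim about the
Yang–Mills mass gap

T. Bałaban, *Spaces of regular gauge field configurations …*, Commun. Math. Phys. **99** (1985) 75–102 `[Balaban1985RegularSpaces]` ("B8"): Prop. 5
(1.106)–(1.109) p. 94 («there exists exactly one function λ»; «Such a configuration u′ is unique in the domain |λ|, |Dλ|₍₋₁₎ < c₃»), Thm 4 p. 88,
p. 89 (base of the induction), p. 95 (uniqueness paragraph), p. 77 («Ω_j = T_η»), p. 76 (`G = SU(N)`).  STATUS: published, refereed.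

CITATION HEADER (lean-in-tree rule).  Cell `lit-balaban`, seat `lit-balaban-t2s-1` (gen 2), sub-row «G-B8-T2S» (R3 `stmt-QuantumFields-19200`,
`--supports`, helper), route P layer L4.  WHAT IS REPRODUCED.  The two servers of `B8Thm2TorusServerP2` (gen 0) composed `B8SockHFPTorusTraceFree`
(the `τ`-free ∃λ-bodies) with `B8Thm2TorusServerP.sockP5Step_body_of_traceFree` (G-valued by the group law; periodic by «exactly one») and
DISPLAYED the «exactly one» as a hypothesis `hUq` with NO datum clause (all `u₁, U₁`), which no proof of Proposition 5 inhabits.  Here the same two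
servers are re-run with that hypothesis DISCHARGED by `B8Prop5StepUniq.prop5_unique_step ∕ prop5_unique_base` (Prop. 5's uniqueness (1.109) in
its native shape, at the torus member, from the letters at the truncation `m + 1` ∕ `1`), and the Theorem-2-level uniqueness socket is served from
`B8SockP5uEAssemblyB.sockP5uE_body_of_join_b` at the one background:
* §1 **`huniq_step_torus`**, **`huniq_base_torus`** — the «exactly one» clauses of `sockP5Step_body_of_traceFree` ∕ `sockP5Base_body_of_traceFree`
  AT THE DATUM, from `LettersAt … (m+1) α₀ U₀` ∕ `LettersAt … 1 α₀ U₀` (laws (U1)–(U3) + (E3)–(E8), (E11)–(E12), (E15) at the top truncation), the b9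
  socket at level `m`, and the uniqueness windows in the shape of `B8SockP5uEWindows.uniqWindows_of_guard` AT `2B₀` (one instance serves base —
  `c_DA ≥ 2dL²c⋆` — and step).
* §2 ★ **`sockP5Step_of_lettersAt_u`**, ★ **`sockP5Base_of_lettersAt_u`** — `B8Thm2TorusSupplier.SockP5Step … G U₀ U′ m` (every `1 ≤ m < k`) and
  `SockP5Base … G U₀ U′` at `c⋆ = 5dLB₀(α₀ + α₁)`, `α₄ = 8B₀′·5dLB₀·(α₀ + α₁)`: `B8Thm2TorusServerP2.sockP5Step_of_lettersAt` ∕ `sockP5Base_of_lettersAt`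
  VERBATIM with `hUq` replaced by §1 (extra inputs: the letters at every truncation `ℓu`, a free radius `α₄ᵘ > 0`, the uniqueness windows, `α₄ < c_u`).
* §3 ★ **`sockP5Uniq_of_lettersAt`** — `B8Thm2TorusSupplier.SockP5Uniq L k P η c_A c_u G U₀ U′` at `c_A = 5dLB₀(α₀ + α₁′)` for ANY `α₁′` dominating the
  all-levels closeness (1.66) (so that `c_A` can be Theorem 2's `B₁(α₀ + α₁)`): `sockP5uE_body_of_join_b` at `Ω_j = T_η`, `Λ_j = torusLam`, letters
  `LettersAt … k α₀ U₀`, b9 at the top, uniqueness windows at `(α₀, α₁′)`.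

## HONEST SCOPE
(i) Compositions; Proposition 5 is NOT re-proved; the letters (`B8Thm2TorusLetters.LettersAt` at the ONE background `U₀`, every truncation), the
b9 socket `SockB9P3` (all unitary backgrounds of the class on `ℤᵈ`) and the J-SU group data are hypotheses; windows explicit and merely sufficient
(thresholds: `B8SockHFPWindows.hfpWindows_of_guard`, `B8SockP5uEWindows.uniqWindows_of_guard` at `2B₀`).  (ii) The letters' laws are read at
arbitrary (not only periodic) arguments — v2 binder; lead RULING #4 (v3, periodic arguments only) is NOT implemented here.  (iii) `d ≥ 2`, `L ≥ 2`,
`G ≤ U(𝔸)` averaging-closed, `𝔸` a C⋆-algebra, `P ∈ Lᵏℤ`.  Count-neutral; N05 ∕ `stub_PV3A` NOT discharged; Theorem 2 not claimed here; nothing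
continuum ∕ ℝ⁴ ∕ OS ∕ mass-gap ∕ Clay.  No `sorry`, no `def`, no `… : Prop` fact, no `instance`, no `notation`.
-/

noncomputable section

open NormedSpace
open scoped BigOperators

namespace Literature.MathematicalPhysics.QuantumFieldTheory.Balaban1983to89.B8Thm2TorusServerP3

open Complex (I)
open MatrixLog (mlog)
open B7Prop1Explicit B7Prop2Explicit B7Prop1Local B7Eq92Concrete
open B7Prop2Explicit (C0 c2')
open B7Prop3Flat (c3)
open B7Prop10General (C6 C4G)
open B7Prop10Flat (one_le_C5)
open B7Prop9Flat (C5')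
open B7Eq78Linearization (conjR)
open B8Ineq132 (covDerivFwd InAk)
open B8Eq119TwistedAxial (Restr129 InAx)
open B8Eq184Proof (gaugeExp cfgExp)
open B8Lemma1NonAbelian (mulCfg)
open B8Eq140Level (SideTouches)
open B8Eq138LandauZd (IsLandau138 IsLandau138W)
open B8Ineq125Concrete (C2p)
open B8LeafModelZd3 (SockB9P3)
open B8Prop5ContractionKLevel (Mc Kc)
open B8Thm4TorusAt (torusLam mem_torusLam_iff)
open B8Thm2TorusMember (torusLamb mem_torusLamb_iff)
open B8Thm2TorusLetters (LettersAt LettersTau torus_member_laws)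
open B8Thm2TorusSupplier (SockP5Step SockP5Base SockP5Uniq sideTouches_univ)
open B8SockHFPTorusTraceFree (sockHFPτ_family_of_lettersAt sockHFP₀τ_family_of_lettersAt)
open B8Thm2TorusServerP (sockP5Step_body_of_traceFree sockP5Base_body_of_traceFree)
open B8Prop5StepUniq (prop5_unique_step prop5_unique_base)
open B8SockP5uEAssemblyB (sockP5uE_body_of_join_b)
open QuantumLattice (blockSites)

-- `Site` alone could resolve to the torus sites of `Setup.lean`; re-export the `ℤ^d` sites of `B7Prop1Explicit`.
export B7Prop1Explicit (Site)

variable {d : ℕ} {𝔸 : Type*} [CStarAlgebra 𝔸] [Nontrivial 𝔸]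

/-! ## §0 The torus member's index laws in the JOIN's shapes -/

omit [CStarAlgebra 𝔸] [Nontrivial 𝔸] in
/-- On the torus member every constraint bond of `torusLamb m j` is INTERIOR: both ends lie in `torusLam m j = T^{(m)}` (the first alternative of
the `ZdIdx` bond-class law). [cite: Balaban1985RegularSpaces, (1.28) p.81, p.77 («Ω_j = T_η»)] -/
theorem torus_hclass {L : ℕ} (k : ℕ) :
    ∀ m, m ≤ k → ∀ j, j ≤ m → ∀ c ∈ (fun m' => torusLamb (d := d) m') m j,
      (c.1 ∈ (fun m' => torusLam (d := d) m') m j ∧ c.1 + e c.2 ∈ (fun m' => torusLam (d := d) m') m j) ∨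
      (∃ j', j = j' + 1 ∧ (∀ x, (L : ℤ) • c.1 ≤ x → x ≤ (L : ℤ) • c.1 + B8Thm2LogB.blockTop L → x ∈ (fun m' => torusLam (d := d) m') m j') ∧
        c.1 + e c.2 ∈ (fun m' => torusLam (d := d) m') m j) ∨
      (∃ j', j = j' + 1 ∧ c.1 ∈ (fun m' => torusLam (d := d) m') m j ∧
        (∀ x, (L : ℤ) • (c.1 + e c.2) ≤ x → x ≤ (L : ℤ) • (c.1 + e c.2) + B8Thm2LogB.blockTop L → x ∈ (fun m' => torusLam (d := d) m') m j')) := by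
  intro m _ j _ c hc
  have hj : j = m := (mem_torusLamb_iff m j c).1 hc
  subst hj
  exact Or.inl ⟨(mem_torusLam_iff j j c.1).2 rfl, (mem_torusLam_iff j j (c.1 + e c.2)).2 rfl⟩

/-! ## §1 Print's «exactly one λ» at the torus datum, from the letters at the next truncation -/

section Uniq

variable (k : ℕ)

/-- **«EXACTLY ONE λ» FOR THE LEVEL-`m` DATUM ON `T_η` — the `huniq` clause of `B8Thm2TorusServerP.sockP5Step_body_of_traceFree` DISCHARGED**
(Prop. 5 (1.109), native step shape, `B8Prop5StepUniq.prop5_unique_step` at `Ω_j = T_η`, `Λ_j = torusLam`, `Λb = torusLamb`): for a unitary pair in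
Theorem 4's regime on `T_η` at `k` levels ((1.33), (1.34), all-truncations axial, the all-levels closeness `≤ α₁`), a unitary level-`m` datum
`(u₁, U₁ = e^{iηA})` (`U₁^{u₁} = U′`, (1.29) and Landau at `m` levels, `|A| ≤ c⋆(Lᵐη)⁻¹`, `c⋆ = 5dLB₀(α₀ + α₁)`), the b9 socket at level `m`, the letters
`LettersAt … (m + 1) α₀ U₀` and the uniqueness windows at `2B₀` with a radius `α₄ᵘ` and domain `c_u`: two competitors `v = e^{iλ}`, `w = e^{iμ}`
(`λ, μ` Hermitian, `|·| < c_u`, `(L^{m+1}η)|D·| < c_u` everywhere) with `U₁^{v⁻¹}`, `U₁^{w⁻¹}` Landau at `m + 1` levels and `u₁v`, `u₁w` restricted at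
`m + 1` levels coincide. [cite: Balaban1985RegularSpaces, Prop. 5 (1.107)–(1.109) p.94, (1.68)–(1.69) p.88, p.77; Balaban1985BackgroundPropagators, Thm 3.1 p.397] -/
theorem huniq_step_torus (hd2 : 2 ≤ d) {L : ℕ} (hL : 2 ≤ L) {η : ℝ} (hη : 0 < η) {m : ℕ} (hm1 : 1 ≤ m) (hmk : m < k)
    {α₀ α₁ B₀ α₄u cu : ℝ} (hα₀ : 0 < α₀) (hα₁ : 0 < α₁) (hB₀ : 0 < B₀) (hα₄u : 0 < α₄u)
    {U₀ U' : Site d → Fin d → 𝔸ˣ} (hU₀ : ∀ x κ, U₀ x κ ∈ unitaryUnits 𝔸) (hU' : ∀ x κ, U' x κ ∈ unitaryUnits 𝔸)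
    (h33 : InAk L k η α₀ (fun _ => (Set.univ : Set (Site d))) U₀) (h34 : InAk L k η α₀ (fun _ => (Set.univ : Set (Site d))) (mulCfg U' U₀))
    (hAx : ∀ m', m' ≤ k → InAx L m' (torusLam (d := d) m') U₀ (mulCfg U' U₀))
    (h135 : ∀ j, j ≤ k → ∀ (z : Site d) (μ : Fin d), (∀ x, InBox (loK L j z) (bondHiK L j z μ) x → x ∈ (fun _ => (Set.univ : Set (Site d))) j) →
      ‖(avgIter L (mulCfg U' U₀) j z μ : 𝔸) - (avgIter L U₀ j z μ : 𝔸)‖ ≤ α₁)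
    {u₁ : Site d → 𝔸ˣ} {U₁ : Site d → Fin d → 𝔸ˣ} {A : Site d → Fin d → 𝔸}
    (hu₁ : ∀ x, u₁ x ∈ unitaryUnits 𝔸) (hW : mgauge U₀ u₁ U₁ = U') (h129 : Restr129 L m (torusLam (d := d) m) U₀ u₁)
    (hLan : IsLandau138W L m η (Set.univ : Set (Site d)) (torusLam (d := d) m) U₀ U₁)
    (hdat : ∀ (x : Site d) (κ : Fin d), U₁ x κ = cfgExp η A x κ ∧ IsSelfAdjoint (A x κ) ∧
      ‖A x κ‖ ≤ (5 * (d : ℝ) * L * B₀ * (α₀ + α₁)) * ((L : ℝ) ^ m * η)⁻¹)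
    {B₀β cB9 β : ℝ} {len : Site d → ℝ}
    (SB9 : SockB9P3 (𝔸 := 𝔸) L B₀ B₀β cB9 β len η m (fun _ => (Set.univ : Set (Site d))) (fun m' => torusLam (d := d) m')
      (fun m' => torusLamb (d := d) m'))
    {BG BR B₀'H B₂' B₀ℓ B₀βℓ cBℓ βℓ : ℝ} {lenℓ : Site d → ℝ} (hB₀'H : 0 < B₀'H) (hB₂' : 0 ≤ B₂') (hBG : 0 ≤ BG) (hBR : 0 ≤ BR)
    (ℓ' : LettersAt (𝔸 := 𝔸) L BG BR B₀'H B₂' B₀ℓ B₀βℓ cBℓ βℓ lenℓ η (m + 1) α₀ U₀)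
    -- the uniqueness windows at `(α₀, α₁)`, instance `2B₀` of `B8SockP5uEWindows.uniqWindows_of_guard`
    (huw : ∀ cs cB cDA hE hE₂ lE lE₂ : ℝ, cs = 5 * (d : ℝ) * L * (2 * B₀) * (α₀ + α₁) → cB = L * cs → cDA = (d : ℝ) * (L : ℝ) ^ 2 * cs →
      hE = B₀'H * (C2p d * (40 * d * cB + α₄u) * α₄u) → hE₂ = B₂' * (C2p d * (40 * d * cB + α₄u) * α₄u) →
      lE = B₀'H * (4 * C2p d * (40 * d * cB + 2 * α₄u)) → lE₂ = B₂' * (4 * C2p d * (40 * d * cB + 2 * α₄u)) →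
      36 * d * (2 * B₀) * cs ≤ 1 / 2 ∧
      8 * (131072 * ((d : ℝ) + 1) ^ 2) * Real.exp (4 * (800 * ((d : ℝ) + 1) ^ 2 * ((d : ℝ) + 4)) * α₀) ≤ 16 * (131072 * ((d : ℝ) + 1) ^ 2) ∧
      2 * cs ^ 2 + 20 * d * α₀ * cs + 2 * (16 * (131072 * ((d : ℝ) + 1) ^ 2)) * cs ^ 2 ≤ α₀ + α₁ ∧
      (d : ℝ) * L * α₁ ≤ 1 / 8 ∧
      α₀ ≤ cB9 ∧ cs ≤ cB9 ∧
      C0 d * α₀ ≤ 1 / 3 ∧ 4 * α₀ ≤ c2' d L ∧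
      Real.exp (4 * (800 * ((d : ℝ) + 1) ^ 2 * ((d : ℝ) + 4)) * α₀) * (1 + 8 * (131072 * ((d : ℝ) + 1) ^ 2) * cB) ≤ 2 ∧
      2 * cB ≤ c3 d L ∧ 2048 * (d : ℝ) * cB ≤ 1 ∧ 40 * d * cB ≤ 1 / 200 ∧
      200 * C6 d * (2 * α₄u) ≤ 1 ∧ 12000 * ((d : ℝ) + 1) * L * (2 * α₄u) ≤ 1 ∧
      C4G d L * (α₀ + 40 * d * cB + 4 * (2 * α₄u)) ≤ 1 ∧
      1024 * ((d : ℝ) + 1) * ((d : ℝ) + 4) * L ^ 2 * α₀ ≤ 1 ∧ 32 * ((d : ℝ) + 1) ^ 2 * C6 d * L ^ 2 * α₀ ≤ 1 ∧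
      16 * d * C5' d * C6 d * (L : ℝ) ^ 2 * α₀ ≤ 1 ∧ 8 * d * C6 d * L * α₀ ≤ 1 ∧
      40 * d * cB + α₄u ≤ 1 / (4 * B₀'H * (2 * C2p d)) ∧ 2 * C6 d * (40 * d * cB + 4 * α₄u) ≤ 1 / 8 ∧
      cB ≤ 1 / 13 ∧ α₄u / 4 + hE ≤ 1 / 24 ∧ α₄u / 4 + hE ≤ 1 / 140 ∧ 10 * (α₄u / 4 + hE) * BR ≤ 1 / 2 ∧
      BG * Mc d BR (α₄u / 4 + hE) cB hE₂ cDA ≤ α₄u / 4 ∧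
      BG * Kc d BR (α₄u / 4 + hE) cB hE₂ cDA lE₂ (1 + lE) (1 + lE) ≤ 1 / 2 ∧
      lE ≤ 1 / 2 ∧ cu + hE ≤ α₄u / 4)
    {v w : Site d → 𝔸ˣ} {lam mu : Site d → 𝔸}
    (hv : ∀ x, ((gaugeExp lam x : 𝔸ˣ) : 𝔸) = ((v x : 𝔸ˣ) : 𝔸) ∧ IsSelfAdjoint (lam x) ∧ ‖lam x‖ < cu)
    (hvD : ∀ (x : Site d) (κ : Fin d), ((L : ℝ) ^ (m + 1) * η) * ‖covDerivFwd η U₀ κ lam x‖ < cu)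
    (hw : ∀ x, ((gaugeExp mu x : 𝔸ˣ) : 𝔸) = ((w x : 𝔸ˣ) : 𝔸) ∧ IsSelfAdjoint (mu x) ∧ ‖mu x‖ < cu)
    (hwD : ∀ (x : Site d) (κ : Fin d), ((L : ℝ) ^ (m + 1) * η) * ‖covDerivFwd η U₀ κ mu x‖ < cu)
    (hLv : IsLandau138W L (m + 1) η (Set.univ : Set (Site d)) (torusLam (m + 1)) U₀ (mgauge U₀ v⁻¹ U₁))
    (hRv : Restr129 L (m + 1) (torusLam (m + 1)) U₀ (u₁ * v))
    (hLw : IsLandau138W L (m + 1) η (Set.univ : Set (Site d)) (torusLam (m + 1)) U₀ (mgauge U₀ w⁻¹ U₁))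
    (hRw : Restr129 L (m + 1) (torusLam (m + 1)) U₀ (u₁ * w)) :
    ∀ x, v x = w x := by
  have hL1 : 1 ≤ L := le_trans (by norm_num) hL
  have hLr : (1 : ℝ) ≤ L := by exact_mod_cast hL1
  have hd1 : 1 ≤ d := by omega
  have hd0 : (1 : ℝ) ≤ d := by exact_mod_cast hd1
  obtain ⟨hΩ, hΩ0, htw, h8lt, h8top⟩ := torus_member_laws (d := d) hL k
  -- the windows at `(α₀, α₁)`, instance `2B₀`
  obtain ⟨hside2, hC₂, h61₂, hsmall₁, hα₀9, hcs9₂, hα3, hα4, hsmall, hc₃, hsc, hα₃', hs₁, hs₂, hs₃, hs₄, hs₅, hs₆, hs₇, hsm, hprod8, hcA', ha₁',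
    hb₁', hθ, h103, h106, hlE, hcu⟩ := huw _ _ _ _ _ _ _ rfl rfl rfl rfl rfl rfl rfl
  have hsum : 0 ≤ α₀ + α₁ := by linarith
  have hcs0 : 0 ≤ 5 * (d : ℝ) * L * B₀ * (α₀ + α₁) := by positivity
  have hcs2 : 5 * (d : ℝ) * L * (2 * B₀) * (α₀ + α₁) = 2 * (5 * (d : ℝ) * L * B₀ * (α₀ + α₁)) := by ring
  have h12 : 5 * (d : ℝ) * L * B₀ * (α₀ + α₁) ≤ 5 * (d : ℝ) * L * (2 * B₀) * (α₀ + α₁) := by rw [hcs2]; linarith only [hcs0]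
  -- the JOIN's free sizes at the doubled scale dominate the datum's
  have hcBlo : L * (5 * (d : ℝ) * L * B₀ * (α₀ + α₁)) ≤ L * (5 * (d : ℝ) * L * (2 * B₀) * (α₀ + α₁)) :=
    mul_le_mul_of_nonneg_left h12 (Nat.cast_nonneg L)
  have hcDAlo : (d : ℝ) * (L : ℝ) ^ 2 * (5 * (d : ℝ) * L * B₀ * (α₀ + α₁)) ≤
      (d : ℝ) * (L : ℝ) ^ 2 * (5 * (d : ℝ) * L * (2 * B₀) * (α₀ + α₁)) :=
    mul_le_mul_of_nonneg_left h12 (by positivity)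
  have hside : 36 * d * B₀ * (5 * (d : ℝ) * L * B₀ * (α₀ + α₁)) ≤ 1 / 2 := by
    have hB2 : 36 * (d : ℝ) * B₀ ≤ 36 * d * (2 * B₀) := by nlinarith only [hB₀.le, Nat.cast_nonneg (α := ℝ) d]
    exact (mul_le_mul hB2 h12 hcs0 (by positivity)).trans hside2
  have h61 : 2 * (5 * (d : ℝ) * L * B₀ * (α₀ + α₁)) ^ 2 + 20 * d * α₀ * (5 * (d : ℝ) * L * B₀ * (α₀ + α₁))
      + 2 * (16 * (131072 * ((d : ℝ) + 1) ^ 2)) * (5 * (d : ℝ) * L * B₀ * (α₀ + α₁)) ^ 2 ≤ α₀ + α₁ := by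
    have hsq : (5 * (d : ℝ) * L * B₀ * (α₀ + α₁)) ^ 2 ≤ (5 * (d : ℝ) * L * (2 * B₀) * (α₀ + α₁)) ^ 2 := pow_le_pow_left₀ hcs0 h12 2
    have hlin : 20 * d * α₀ * (5 * (d : ℝ) * L * B₀ * (α₀ + α₁)) ≤ 20 * d * α₀ * (5 * (d : ℝ) * L * (2 * B₀) * (α₀ + α₁)) :=
      mul_le_mul_of_nonneg_left h12 (by positivity)
    have hsq2 : 2 * (16 * (131072 * ((d : ℝ) + 1) ^ 2)) * (5 * (d : ℝ) * L * B₀ * (α₀ + α₁)) ^ 2 ≤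
        2 * (16 * (131072 * ((d : ℝ) + 1) ^ 2)) * (5 * (d : ℝ) * L * (2 * B₀) * (α₀ + α₁)) ^ 2 := mul_le_mul_of_nonneg_left hsq (by positivity)
    linarith only [h61₂, hsq, hlin, hsq2]
  have hcs9 : 5 * (d : ℝ) * L * B₀ * (α₀ + α₁) ≤ cB9 := h12.trans hcs9₂
  -- the datum in the sides-form, every `j ≤ m`
  have hdat' : ∀ j, j ≤ m → ∀ b ∈ {b : Site d × Fin d | SideTouches ((fun _ => (Set.univ : Set (Site d))) j) b.1 b.2},
      U₁ b.1 b.2 = cfgExp η A b.1 b.2 ∧ IsSelfAdjoint (A b.1 b.2) ∧ ‖A b.1 b.2‖ ≤ (5 * (d : ℝ) * L * B₀ * (α₀ + α₁)) * ((L : ℝ) ^ j * η)⁻¹ := by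
    intro j hj b _
    obtain ⟨h1, h2, h3⟩ := hdat b.1 b.2
    refine ⟨h1, h2, h3.trans (mul_le_mul_of_nonneg_left ?_ hcs0)⟩
    rw [mul_inv, mul_inv]
    refine mul_le_mul_of_nonneg_right ?_ (by positivity)
    exact inv_anti₀ (by positivity) (pow_le_pow_right₀ hLr hj)
  -- the competitors' gradient clauses in the sides-form, every `j ≤ m + 1`
  have hgrad : ∀ {l : Site d → 𝔸}, (∀ (x : Site d) (κ : Fin d), ((L : ℝ) ^ (m + 1) * η) * ‖covDerivFwd η U₀ κ l x‖ < cu) →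
      ∀ j, j ≤ m + 1 → ∀ b ∈ {b : Site d × Fin d | SideTouches ((fun _ => (Set.univ : Set (Site d))) j) b.1 b.2},
        ((L : ℝ) ^ j * η) * ‖covDerivFwd η U₀ b.2 l b.1‖ < cu := by
    intro l hl j hj b _
    refine lt_of_le_of_lt ?_ (hl b.1 b.2)
    exact mul_le_mul_of_nonneg_right (mul_le_mul_of_nonneg_right (pow_le_pow_right₀ hLr hj) hη.le) (norm_nonneg _)
  have hm1' : 1 ≤ m + 1 := by omega
  exact prop5_unique_step (k := k) hd2 hL hη (Ω := fun _ => (Set.univ : Set (Site d))) hΩ hΩ0 (Λs := fun m' => torusLam (d := d) m')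
    (Λb := fun m' => torusLamb (d := d) m') (fun _ _ _ _ _ _ _ _ => Set.mem_univ _) (torus_hclass k) hm1 hmk (htw (m + 1) hmk) (h8lt m hmk)
    (h8top m hmk) hα₀ hα₁ hB₀ rfl hα₄u hU₀ hU' h33 h34 hAx h135 hu₁ hW h129 hLan hdat' SB9 hα₀9 hcs9 hside hC₂ h61 hsmall₁
    (ℓ'.Gp (m + 1)) (ℓ'.lapU (m + 1)) (ℓ'.Qp (m + 1)) (ℓ'.QpT (m + 1)) (ℓ'.Aw (m + 1)) (ℓ'.Cinv (m + 1)) (ℓ'.gp_left_bdd hm1') (ℓ'.cinv_range' hm1')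
    (ℓ'.lapU_reads (m + 1) hm1' le_rfl) (ℓ'.qpT_reads (m + 1) hm1' le_rfl) (ℓ'.qp_reads (m + 1) hm1' le_rfl) (ℓ'.qp_zero_off hm1')
    (ℓ'.Hp (m + 1)) hB₀'H hB₂' hBG hBR (ℓ'.hp_sup (m + 1) hm1' le_rfl) (ℓ'.hp_grad (m + 1) hm1' le_rfl) (ℓ'.hp_lap (m + 1) hm1' le_rfl)
    (ℓ'.qp_hp (m + 1) hm1' le_rfl) (ℓ'.gp_sup_grad (m + 1) hm1' le_rfl) (ℓ'.r_bound (m + 1) hm1' le_rfl) hcBlo hcBlo hcDAlo hα3 hα4 hsmall hc₃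
    hsc hα₃' hs₁ hs₂ hs₃ hs₄ hs₅ hs₆ hs₇ hsm hprod8 rfl rfl rfl rfl hcA' ha₁' hb₁' hθ h103 h106 hlE hcu hv (hgrad hvD) hw (hgrad hwD) hLv
    hRv hLw hRw

/-- **«EXACTLY ONE λ» FOR THE BASE DATUM `u₁ = 1`, `U₁ = U′` ON `T_η` — the `huniq` clause of `B8Thm2TorusServerP.sockP5Base_body_of_traceFree`
DISCHARGED** (`B8Prop5StepUniq.prop5_unique_base` at the torus member; letters `LettersAt … 1 α₀ U₀`; uniqueness windows at `2B₀`, which give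
`c_DA ≥ 2dL²c⋆`). [cite: Balaban1985RegularSpaces, Prop. 5 (1.107)–(1.109) p.94, p.89 (the start of the induction), p.77; Balaban1985BackgroundPropagators, Thm 3.1 p.397] -/
theorem huniq_base_torus (hd2 : 2 ≤ d) {L : ℕ} (hL : 2 ≤ L) {η : ℝ} (hη : 0 < η) (hk : 1 ≤ k)
    {α₀ α₁ B₀ α₄u cu : ℝ} (hα₀ : 0 < α₀) (hα₁ : 0 < α₁) (hB₀ : 0 < B₀) (hα₄u : 0 < α₄u)
    {U₀ U' : Site d → Fin d → 𝔸ˣ} (hU₀ : ∀ x κ, U₀ x κ ∈ unitaryUnits 𝔸)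
    (h33 : InAk L k η α₀ (fun _ => (Set.univ : Set (Site d))) U₀) (h34 : InAk L k η α₀ (fun _ => (Set.univ : Set (Site d))) (mulCfg U' U₀))
    (hAx : ∀ m', m' ≤ k → InAx L m' (torusLam (d := d) m') U₀ (mulCfg U' U₀))
    {A : Site d → Fin d → 𝔸}
    (hdat : ∀ (x : Site d) (κ : Fin d), U' x κ = cfgExp η A x κ ∧ IsSelfAdjoint (A x κ) ∧
      ‖A x κ‖ ≤ (5 * (d : ℝ) * L * B₀ * (α₀ + α₁)) * ((L : ℝ) ^ 0 * η)⁻¹)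
    {cB9 : ℝ} {BG BR B₀'H B₂' B₀ℓ B₀βℓ cBℓ βℓ : ℝ} {lenℓ : Site d → ℝ} (hB₀'H : 0 < B₀'H) (hB₂' : 0 ≤ B₂') (hBG : 0 ≤ BG) (hBR : 0 ≤ BR)
    (ℓ' : LettersAt (𝔸 := 𝔸) L BG BR B₀'H B₂' B₀ℓ B₀βℓ cBℓ βℓ lenℓ η 1 α₀ U₀)
    (huw : ∀ cs cB cDA hE hE₂ lE lE₂ : ℝ, cs = 5 * (d : ℝ) * L * (2 * B₀) * (α₀ + α₁) → cB = L * cs → cDA = (d : ℝ) * (L : ℝ) ^ 2 * cs →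
      hE = B₀'H * (C2p d * (40 * d * cB + α₄u) * α₄u) → hE₂ = B₂' * (C2p d * (40 * d * cB + α₄u) * α₄u) →
      lE = B₀'H * (4 * C2p d * (40 * d * cB + 2 * α₄u)) → lE₂ = B₂' * (4 * C2p d * (40 * d * cB + 2 * α₄u)) →
      36 * d * (2 * B₀) * cs ≤ 1 / 2 ∧
      8 * (131072 * ((d : ℝ) + 1) ^ 2) * Real.exp (4 * (800 * ((d : ℝ) + 1) ^ 2 * ((d : ℝ) + 4)) * α₀) ≤ 16 * (131072 * ((d : ℝ) + 1) ^ 2) ∧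
      2 * cs ^ 2 + 20 * d * α₀ * cs + 2 * (16 * (131072 * ((d : ℝ) + 1) ^ 2)) * cs ^ 2 ≤ α₀ + α₁ ∧
      (d : ℝ) * L * α₁ ≤ 1 / 8 ∧
      α₀ ≤ cB9 ∧ cs ≤ cB9 ∧
      C0 d * α₀ ≤ 1 / 3 ∧ 4 * α₀ ≤ c2' d L ∧
      Real.exp (4 * (800 * ((d : ℝ) + 1) ^ 2 * ((d : ℝ) + 4)) * α₀) * (1 + 8 * (131072 * ((d : ℝ) + 1) ^ 2) * cB) ≤ 2 ∧
      2 * cB ≤ c3 d L ∧ 2048 * (d : ℝ) * cB ≤ 1 ∧ 40 * d * cB ≤ 1 / 200 ∧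
      200 * C6 d * (2 * α₄u) ≤ 1 ∧ 12000 * ((d : ℝ) + 1) * L * (2 * α₄u) ≤ 1 ∧
      C4G d L * (α₀ + 40 * d * cB + 4 * (2 * α₄u)) ≤ 1 ∧
      1024 * ((d : ℝ) + 1) * ((d : ℝ) + 4) * L ^ 2 * α₀ ≤ 1 ∧ 32 * ((d : ℝ) + 1) ^ 2 * C6 d * L ^ 2 * α₀ ≤ 1 ∧
      16 * d * C5' d * C6 d * (L : ℝ) ^ 2 * α₀ ≤ 1 ∧ 8 * d * C6 d * L * α₀ ≤ 1 ∧
      40 * d * cB + α₄u ≤ 1 / (4 * B₀'H * (2 * C2p d)) ∧ 2 * C6 d * (40 * d * cB + 4 * α₄u) ≤ 1 / 8 ∧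
      cB ≤ 1 / 13 ∧ α₄u / 4 + hE ≤ 1 / 24 ∧ α₄u / 4 + hE ≤ 1 / 140 ∧ 10 * (α₄u / 4 + hE) * BR ≤ 1 / 2 ∧
      BG * Mc d BR (α₄u / 4 + hE) cB hE₂ cDA ≤ α₄u / 4 ∧
      BG * Kc d BR (α₄u / 4 + hE) cB hE₂ cDA lE₂ (1 + lE) (1 + lE) ≤ 1 / 2 ∧
      lE ≤ 1 / 2 ∧ cu + hE ≤ α₄u / 4)
    {v w : Site d → 𝔸ˣ} {lam mu : Site d → 𝔸}
    (hv : ∀ x, ((gaugeExp lam x : 𝔸ˣ) : 𝔸) = ((v x : 𝔸ˣ) : 𝔸) ∧ IsSelfAdjoint (lam x) ∧ ‖lam x‖ < cu)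
    (hvD : ∀ (x : Site d) (κ : Fin d), ((L : ℝ) ^ 1 * η) * ‖covDerivFwd η U₀ κ lam x‖ < cu)
    (hw : ∀ x, ((gaugeExp mu x : 𝔸ˣ) : 𝔸) = ((w x : 𝔸ˣ) : 𝔸) ∧ IsSelfAdjoint (mu x) ∧ ‖mu x‖ < cu)
    (hwD : ∀ (x : Site d) (κ : Fin d), ((L : ℝ) ^ 1 * η) * ‖covDerivFwd η U₀ κ mu x‖ < cu)
    (hLv : IsLandau138W L 1 η (Set.univ : Set (Site d)) (torusLam 1) U₀ (mgauge U₀ v⁻¹ U'))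
    (hRv : Restr129 L 1 (torusLam 1) U₀ ((1 : Site d → 𝔸ˣ) * v))
    (hLw : IsLandau138W L 1 η (Set.univ : Set (Site d)) (torusLam 1) U₀ (mgauge U₀ w⁻¹ U'))
    (hRw : Restr129 L 1 (torusLam 1) U₀ ((1 : Site d → 𝔸ˣ) * w)) :
    ∀ x, v x = w x := by
  have hL1 : 1 ≤ L := le_trans (by norm_num) hL
  have hLr : (1 : ℝ) ≤ L := by exact_mod_cast hL1
  obtain ⟨hΩ, hΩ0, htw, -, -⟩ := torus_member_laws (d := d) hL k
  obtain ⟨-, -, -, -, -, -, hα3, hα4, hsmall, hc₃, hsc, hα₃', hs₁, hs₂, hs₃, hs₄, hs₅, hs₆, hs₇, hsm, hprod8, hcA', ha₁',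
    hb₁', hθ, h103, h106, hlE, hcu⟩ := huw _ _ _ _ _ _ _ rfl rfl rfl rfl rfl rfl rfl
  have hsum : 0 ≤ α₀ + α₁ := by linarith
  have hcs0 : 0 ≤ 5 * (d : ℝ) * L * B₀ * (α₀ + α₁) := by positivity
  have hcs2 : 5 * (d : ℝ) * L * (2 * B₀) * (α₀ + α₁) = 2 * (5 * (d : ℝ) * L * B₀ * (α₀ + α₁)) := by ring
  have h12 : 5 * (d : ℝ) * L * B₀ * (α₀ + α₁) ≤ 5 * (d : ℝ) * L * (2 * B₀) * (α₀ + α₁) := by rw [hcs2]; linarith only [hcs0]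
  have hcBlo : L * (5 * (d : ℝ) * L * B₀ * (α₀ + α₁)) ≤ L * (5 * (d : ℝ) * L * (2 * B₀) * (α₀ + α₁)) :=
    mul_le_mul_of_nonneg_left h12 (Nat.cast_nonneg L)
  have hcDAlo : 2 * (d : ℝ) * (L : ℝ) ^ 2 * (5 * (d : ℝ) * L * B₀ * (α₀ + α₁)) ≤
      (d : ℝ) * (L : ℝ) ^ 2 * (5 * (d : ℝ) * L * (2 * B₀) * (α₀ + α₁)) := by
    rw [hcs2]; exact le_of_eq (by ring)
  -- the datum in the sides-form at `j ≤ 0`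
  have hdat' : ∀ j, j ≤ 0 → ∀ b ∈ {b : Site d × Fin d | SideTouches ((fun _ => (Set.univ : Set (Site d))) j) b.1 b.2},
      U' b.1 b.2 = cfgExp η A b.1 b.2 ∧ IsSelfAdjoint (A b.1 b.2) ∧ ‖A b.1 b.2‖ ≤ (5 * (d : ℝ) * L * B₀ * (α₀ + α₁)) * ((L : ℝ) ^ j * η)⁻¹ := by
    intro j hj b _
    obtain rfl : j = 0 := Nat.le_zero.1 hj
    exact hdat b.1 b.2
  have hgrad : ∀ {l : Site d → 𝔸}, (∀ (x : Site d) (κ : Fin d), ((L : ℝ) ^ 1 * η) * ‖covDerivFwd η U₀ κ l x‖ < cu) →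
      ∀ j, j ≤ 1 → ∀ b ∈ {b : Site d × Fin d | SideTouches ((fun _ => (Set.univ : Set (Site d))) j) b.1 b.2},
        ((L : ℝ) ^ j * η) * ‖covDerivFwd η U₀ b.2 l b.1‖ < cu := by
    intro l hl j hj b _
    refine lt_of_le_of_lt ?_ (hl b.1 b.2)
    exact mul_le_mul_of_nonneg_right (mul_le_mul_of_nonneg_right (pow_le_pow_right₀ hLr hj) hη.le) (norm_nonneg _)
  exact prop5_unique_base (k := k) hd2 hL hη hk (Ω := fun _ => (Set.univ : Set (Site d))) hΩ hΩ0 (Λs := fun m' => torusLam (d := d) m')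
    (htw 1 hk) hα₀ hα₁ hB₀ rfl hα₄u hU₀ h33 h34 hAx hdat'
    (ℓ'.Gp 1) (ℓ'.lapU 1) (ℓ'.Qp 1) (ℓ'.QpT 1) (ℓ'.Aw 1) (ℓ'.Cinv 1) (ℓ'.gp_left_bdd le_rfl) (ℓ'.cinv_range' le_rfl)
    (ℓ'.lapU_reads 1 le_rfl le_rfl) (ℓ'.qpT_reads 1 le_rfl le_rfl) (ℓ'.qp_reads 1 le_rfl le_rfl) (ℓ'.qp_zero_off le_rfl)
    (ℓ'.Hp 1) hB₀'H hB₂' hBG hBR (ℓ'.hp_sup 1 le_rfl le_rfl) (ℓ'.hp_grad 1 le_rfl le_rfl) (ℓ'.hp_lap 1 le_rfl le_rfl)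
    (ℓ'.qp_hp 1 le_rfl le_rfl) (ℓ'.gp_sup_grad 1 le_rfl le_rfl) (ℓ'.r_bound 1 le_rfl le_rfl) hcBlo hcBlo hcDAlo hα3 hα4 hsmall hc₃
    hsc hα₃' hs₁ hs₂ hs₃ hs₄ hs₅ hs₆ hs₇ hsm hprod8 rfl rfl rfl rfl hcA' ha₁' hb₁' hθ h103 h106 hlE hcu hv (hgrad hvD) hw (hgrad hwD) hLv
    hRv hLw hRw

end Uniq

/-! ## §2 Route P's Proposition-5 STEP and BASE sockets with «exactly one» discharged -/

section Step

variable (τ : 𝔸 →L[ℂ] ℂ)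

/-- ★ **ROUTE P's PROPOSITION-5 STEP SOCKET AT EVERY LEVEL `1 ≤ m < k`, «EXACTLY ONE» DISCHARGED** (p. 94 on `T_η`):
`B8Thm2TorusSupplier.SockP5Step L P η c⋆ α₄ G U₀ U′ m` at `c⋆ = 5dLB₀(α₀ + α₁)`, `α₄ = 8B₀′·5dLB₀·(α₀ + α₁)` — `B8Thm2TorusServerP2.sockP5Step_of_lettersAt`
VERBATIM except that its displayed `hUq` is replaced by the letters at every truncation (`ℓu`), a free radius `α₄ᵘ`, the uniqueness windows at `2B₀`
and `α₄ < c_u`, from which `huniq_step_torus` serves print's «exactly one λ». [cite: Balaban1985RegularSpaces, Prop. 5 (1.106)–(1.109) p.94 («there exists exactly one function λ»), Thm 4 p.88, p.77, p.76] -/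
theorem sockP5Step_of_lettersAt_u (hτ : ∀ x y : 𝔸, τ (x * y) = τ (y * x)) (hd2 : 2 ≤ d) {L : ℕ} (hL : 2 ≤ L) {η : ℝ} (hη : 0 < η) {k : ℕ}
    {P : ℤ} (hP : ∃ M : ℤ, P = (L : ℤ) ^ k * M)
    {G H : Subgroup 𝔸ˣ} (hGrp2 : ∀ g ∈ H, ‖(g : 𝔸) - 1‖ ≤ 1 / 8 → τ (mlog (g : 𝔸)) = 0) (hGrp3 : ∀ S : 𝔸, τ S = 0 → expUnit S ∈ H)
    (hGA : AvgClosed d L G) (hGH : G ≤ H) (hGu : G ≤ unitaryUnits 𝔸)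
    (hG3 : ∀ (lam : Site d → 𝔸) (x : Site d), IsSelfAdjoint (lam x) → τ (lam x) = 0 → gaugeExp lam x ∈ G)
    {α₀ α₁ B₀ B₀' B₀'H B₂' BG BR B₀β cB9 cB β cu α₄u : ℝ} {len : Site d → ℝ} (hα₀ : 0 < α₀) (hα₁ : 0 < α₁)
    (hB₀ : 0 < B₀) (hB₀' : 0 < B₀') (hB₀'H : 0 < B₀'H) (hB₂' : 0 ≤ B₂') (hBG : 0 ≤ BG) (hBR : 0 ≤ BR) (hα₄u : 0 < α₄u)
    (hcu : 8 * B₀' * (5 * (d : ℝ) * L * B₀) * (α₀ + α₁) < cu)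
    {U₀ U' : Site d → Fin d → 𝔸ˣ} (hU₀G : ∀ x κ, U₀ x κ ∈ G) (hU'G : ∀ x κ, U' x κ ∈ G)
    (hU₀P : ∀ (x : Site d) (i : Fin d), U₀ (x + P • e i) = U₀ x) (hU'P : ∀ (x : Site d) (i : Fin d), U' (x + P • e i) = U' x)
    (h33 : InAk L k η α₀ (fun _ => (Set.univ : Set (Site d))) U₀) (h34 : InAk L k η α₀ (fun _ => (Set.univ : Set (Site d))) (mulCfg U' U₀))
    (hAx : ∀ m', m' ≤ k → InAx L m' (torusLam (d := d) m') U₀ (mulCfg U' U₀))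
    (h135 : ∀ j, j ≤ k → ∀ (z : Site d) (μ : Fin d), (∀ x, InBox (loK L j z) (bondHiK L j z μ) x → x ∈ (fun _ => (Set.univ : Set (Site d))) j) →
      ‖(avgIter L (mulCfg U' U₀) j z μ : 𝔸) - (avgIter L U₀ j z μ : 𝔸)‖ ≤ α₁)
    (ℓ : LettersAt (𝔸 := 𝔸) L BG BR B₀'H B₂' B₀ B₀β cB β len η k α₀ U₀) (ℓτ : LettersTau (𝔸 := 𝔸) τ ℓ)
    (ℓu : ∀ n, 1 ≤ n → n ≤ k → LettersAt (𝔸 := 𝔸) L BG BR B₀'H B₂' B₀ B₀β cB β len η n α₀ U₀)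
    (SB9all : ∀ m, m ≤ k → SockB9P3 (𝔸 := 𝔸) L B₀ B₀β cB9 β len η m (fun _ => (Set.univ : Set (Site d)))
      (fun m => torusLam (d := d) m) (fun m => torusLamb (d := d) m))
    (hwin : ∀ cs α₄ cB cDA hE hE₂ lE lE₂ : ℝ, cs = 5 * (d : ℝ) * L * B₀ * (α₀ + α₁) → α₄ = 8 * B₀' * (5 * (d : ℝ) * L * B₀) * (α₀ + α₁) →
      cB = L * cs → cDA = 2 * (d : ℝ) * (L : ℝ) ^ 2 * cs →
      hE = B₀'H * (C2p d * (40 * d * cB + α₄) * α₄) → hE₂ = B₂' * (C2p d * (40 * d * cB + α₄) * α₄) →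
      lE = B₀'H * (4 * C2p d * (40 * d * cB + 2 * α₄)) → lE₂ = B₂' * (4 * C2p d * (40 * d * cB + 2 * α₄)) →
      36 * d * B₀ * cs ≤ 1 / 2 ∧
      8 * (131072 * ((d : ℝ) + 1) ^ 2) * Real.exp (4 * (800 * ((d : ℝ) + 1) ^ 2 * ((d : ℝ) + 4)) * α₀) ≤ 16 * (131072 * ((d : ℝ) + 1) ^ 2) ∧
      2 * cs ^ 2 + 20 * d * α₀ * cs + 2 * (16 * (131072 * ((d : ℝ) + 1) ^ 2)) * cs ^ 2 ≤ α₀ + α₁ ∧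
      (d : ℝ) * L * α₁ ≤ 1 / 8 ∧
      α₀ ≤ cB9 ∧ cs ≤ cB9 ∧
      C0 d * α₀ ≤ 1 / 3 ∧ 4 * α₀ ≤ c2' d L ∧
      Real.exp (4 * (800 * ((d : ℝ) + 1) ^ 2 * ((d : ℝ) + 4)) * α₀) * (1 + 8 * (131072 * ((d : ℝ) + 1) ^ 2) * cB) ≤ 2 ∧
      2 * cB ≤ c3 d L ∧ 2048 * (d : ℝ) * cB ≤ 1 ∧ 40 * d * cB ≤ 1 / 200 ∧
      200 * C6 d * (2 * α₄) ≤ 1 ∧ 12000 * ((d : ℝ) + 1) * L * (2 * α₄) ≤ 1 ∧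
      C4G d L * (α₀ + 40 * d * cB + 4 * (2 * α₄)) ≤ 1 ∧
      1024 * ((d : ℝ) + 1) * ((d : ℝ) + 4) * L ^ 2 * α₀ ≤ 1 ∧ 32 * ((d : ℝ) + 1) ^ 2 * C6 d * L ^ 2 * α₀ ≤ 1 ∧
      16 * d * C5' d * C6 d * (L : ℝ) ^ 2 * α₀ ≤ 1 ∧ 8 * d * C6 d * L * α₀ ≤ 1 ∧
      40 * d * cB + α₄ ≤ 1 / (4 * B₀'H * (2 * C2p d)) ∧ 2 * C6 d * (40 * d * cB + 4 * α₄) ≤ 1 / 8 ∧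
      cB ≤ 1 / 13 ∧ α₄ / 4 + hE ≤ 1 / 24 ∧ α₄ / 4 + hE ≤ 1 / 140 ∧ 10 * (α₄ / 4 + hE) * BR ≤ 1 / 2 ∧
      BG * Mc d BR (α₄ / 4 + hE) cB hE₂ cDA ≤ α₄ / 4 ∧
      BG * Kc d BR (α₄ / 4 + hE) cB hE₂ cDA lE₂ (1 + lE) (1 + lE) ≤ 1 / 2)
    (huw : ∀ cs cB cDA hE hE₂ lE lE₂ : ℝ, cs = 5 * (d : ℝ) * L * (2 * B₀) * (α₀ + α₁) → cB = L * cs → cDA = (d : ℝ) * (L : ℝ) ^ 2 * cs →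
      hE = B₀'H * (C2p d * (40 * d * cB + α₄u) * α₄u) → hE₂ = B₂' * (C2p d * (40 * d * cB + α₄u) * α₄u) →
      lE = B₀'H * (4 * C2p d * (40 * d * cB + 2 * α₄u)) → lE₂ = B₂' * (4 * C2p d * (40 * d * cB + 2 * α₄u)) →
      36 * d * (2 * B₀) * cs ≤ 1 / 2 ∧
      8 * (131072 * ((d : ℝ) + 1) ^ 2) * Real.exp (4 * (800 * ((d : ℝ) + 1) ^ 2 * ((d : ℝ) + 4)) * α₀) ≤ 16 * (131072 * ((d : ℝ) + 1) ^ 2) ∧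
      2 * cs ^ 2 + 20 * d * α₀ * cs + 2 * (16 * (131072 * ((d : ℝ) + 1) ^ 2)) * cs ^ 2 ≤ α₀ + α₁ ∧
      (d : ℝ) * L * α₁ ≤ 1 / 8 ∧
      α₀ ≤ cB9 ∧ cs ≤ cB9 ∧
      C0 d * α₀ ≤ 1 / 3 ∧ 4 * α₀ ≤ c2' d L ∧
      Real.exp (4 * (800 * ((d : ℝ) + 1) ^ 2 * ((d : ℝ) + 4)) * α₀) * (1 + 8 * (131072 * ((d : ℝ) + 1) ^ 2) * cB) ≤ 2 ∧
      2 * cB ≤ c3 d L ∧ 2048 * (d : ℝ) * cB ≤ 1 ∧ 40 * d * cB ≤ 1 / 200 ∧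
      200 * C6 d * (2 * α₄u) ≤ 1 ∧ 12000 * ((d : ℝ) + 1) * L * (2 * α₄u) ≤ 1 ∧
      C4G d L * (α₀ + 40 * d * cB + 4 * (2 * α₄u)) ≤ 1 ∧
      1024 * ((d : ℝ) + 1) * ((d : ℝ) + 4) * L ^ 2 * α₀ ≤ 1 ∧ 32 * ((d : ℝ) + 1) ^ 2 * C6 d * L ^ 2 * α₀ ≤ 1 ∧
      16 * d * C5' d * C6 d * (L : ℝ) ^ 2 * α₀ ≤ 1 ∧ 8 * d * C6 d * L * α₀ ≤ 1 ∧
      40 * d * cB + α₄u ≤ 1 / (4 * B₀'H * (2 * C2p d)) ∧ 2 * C6 d * (40 * d * cB + 4 * α₄u) ≤ 1 / 8 ∧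
      cB ≤ 1 / 13 ∧ α₄u / 4 + hE ≤ 1 / 24 ∧ α₄u / 4 + hE ≤ 1 / 140 ∧ 10 * (α₄u / 4 + hE) * BR ≤ 1 / 2 ∧
      BG * Mc d BR (α₄u / 4 + hE) cB hE₂ cDA ≤ α₄u / 4 ∧
      BG * Kc d BR (α₄u / 4 + hE) cB hE₂ cDA lE₂ (1 + lE) (1 + lE) ≤ 1 / 2 ∧
      lE ≤ 1 / 2 ∧ cu + hE ≤ α₄u / 4) :
    ∀ m, 1 ≤ m → m < k →
      SockP5Step (𝔸 := 𝔸) L P η (5 * (d : ℝ) * L * B₀ * (α₀ + α₁)) (8 * B₀' * (5 * (d : ℝ) * L * B₀) * (α₀ + α₁)) G U₀ U' m := by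
  intro m hm1 hmk u₁ U₁ A hu₁G hu₁P hW h129 hLan hdat
  have hL1 : 1 ≤ L := le_trans (by norm_num) hL
  have hLr : (1 : ℝ) ≤ L := by exact_mod_cast hL1
  have hU₀ : ∀ x κ, U₀ x κ ∈ unitaryUnits 𝔸 := fun x κ => hGu (hU₀G x κ)
  have hU' : ∀ x κ, U' x κ ∈ unitaryUnits 𝔸 := fun x κ => hGu (hU'G x κ)
  have hu₁ : ∀ x, u₁ x ∈ unitaryUnits 𝔸 := fun x => hGu (hu₁G x)
  -- two of the windows: `α₄ ≤ 1/84` and `c⋆ ≤ 1/12`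
  obtain ⟨-, -, -, -, -, -, -, -, -, -, -, hα₃', hs₁, -⟩ := hwin _ _ _ _ _ _ _ _ rfl rfl rfl rfl rfl rfl rfl rfl
  have hsum : 0 ≤ α₀ + α₁ := by linarith
  have hcs0 : 0 ≤ 5 * (d : ℝ) * L * B₀ * (α₀ + α₁) := by positivity
  have hC6 : (2 : ℝ) ≤ C6 d := by unfold C6; linarith [one_le_C5 (d := d)]
  have hα84 : 8 * B₀' * (5 * (d : ℝ) * L * B₀) * (α₀ + α₁) ≤ 1 / 84 := by
    have h0 : 0 ≤ 8 * B₀' * (5 * (d : ℝ) * L * B₀) * (α₀ + α₁) := by positivity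
    nlinarith [hs₁, hC6, h0]
  have hcs12 : 5 * (d : ℝ) * L * B₀ * (α₀ + α₁) ≤ 1 / 12 := by
    have hd0 : (1 : ℝ) ≤ d := by exact_mod_cast (show 1 ≤ d by omega)
    have hcsB : 5 * (d : ℝ) * L * B₀ * (α₀ + α₁) ≤ L * (5 * (d : ℝ) * L * B₀ * (α₀ + α₁)) := le_mul_of_one_le_left hcs0 hLr
    have hcBsmall : (d : ℝ) * (L * (5 * (d : ℝ) * L * B₀ * (α₀ + α₁))) ≤ 1 / 8000 := by linarith only [hα₃']
    have h1 : 5 * (d : ℝ) * L * B₀ * (α₀ + α₁) ≤ 1 / 8000 :=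
      ((le_mul_of_one_le_left hcs0 hd0).trans (mul_le_mul_of_nonneg_left hcsB (by positivity))).trans hcBsmall
    linarith only [h1]
  -- the datum's (1.69) on the bonds touching `T_η` at every `j ≤ m` from the level-`m` bound
  have hdat' : ∀ j, j ≤ m → ∀ b ∈ {b : Site d × Fin d | SideTouches ((fun _ => (Set.univ : Set (Site d))) j) b.1 b.2},
      U₁ b.1 b.2 = cfgExp η A b.1 b.2 ∧ IsSelfAdjoint (A b.1 b.2) ∧ ‖A b.1 b.2‖ ≤ (5 * (d : ℝ) * L * B₀ * (α₀ + α₁)) * ((L : ℝ) ^ j * η)⁻¹ := by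
    intro j hj b _
    obtain ⟨h1, h2, h3⟩ := hdat b.1 b.2
    refine ⟨h1, h2, h3.trans (mul_le_mul_of_nonneg_left ?_ hcs0)⟩
    rw [mul_inv, mul_inv]
    refine mul_le_mul_of_nonneg_right ?_ (by positivity)
    exact inv_anti₀ (by positivity) (pow_le_pow_right₀ hLr hj)
  -- the `τ`-free ∃λ-body at this datum
  have hbody := sockHFPτ_family_of_lettersAt τ hτ hd2 hL hη hGrp2 hGrp3 hGA hGH hGu hα₀ hα₁ hB₀ hB₀' hB₀'H hB₂' hBG hBR hU₀G hU'G h33 h34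
    hAx h135 ℓ ℓτ SB9all hwin m hm1 hmk u₁ U₁ A hu₁G hW h129 hLan hdat'
  -- `P ∈ L^{m+1}ℤ` and the periodicity of `U₁ = u₁⁻¹U′u₁(· + e)`
  have hP' : ∃ c : ℤ, P = (L : ℤ) ^ (m + 1) * c := by
    obtain ⟨M, hM⟩ := hP
    refine ⟨(L : ℤ) ^ (k - (m + 1)) * M, ?_⟩
    rw [hM, ← mul_assoc, ← pow_add, Nat.add_sub_cancel' (by omega : m + 1 ≤ k)]
  have hU₁P : ∀ (x : Site d) (i : Fin d), U₁ (x + P • e i) = U₁ x := by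
    intro x i
    have key : ∀ y κ, U₁ y κ = (u₁ y)⁻¹ * U' y κ * Rc (U₀ y κ) (u₁ (y + e κ)) := fun y κ => by
      have h := congrFun (congrFun hW y) κ
      rw [mgauge_apply] at h
      rw [← h]; group
    funext κ
    rw [key, key, hu₁P, hU'P, hU₀P, add_right_comm, hu₁P]
  -- print's «exactly one λ» at this datum, from the letters at the truncation `m + 1`
  have huniq := fun (v w : Site d → 𝔸ˣ) (lam mu : Site d → 𝔸) hv hvD hw hwD hLv hRv hLw hRw =>
    huniq_step_torus k hd2 hL hη hm1 hmk hα₀ hα₁ hB₀ hα₄u hU₀ hU' h33 h34 hAx h135 hu₁ hW h129 hLan hdat (SB9all m hmk.le) hB₀'H hB₂' hBG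
      hBR (ℓu (m + 1) (by omega) (by omega)) huw (v := v) (w := w) (lam := lam) (mu := mu) hv hvD hw hwD hLv hRv hLw hRw
  exact sockP5Step_body_of_traceFree hd2 hη hL1 m hP' τ hG3 hU₀ hU₀P hU₁P hu₁P hα84 hcs12 hcu hdat hbody huniq

/-- ★ **ROUTE P's PROPOSITION-5 BASE SOCKET (`u₁ = 1`, `U₁ = U′`, p. 89), «EXACTLY ONE» DISCHARGED**: `B8Thm2TorusSupplier.SockP5Base L P η α₄ G U₀ U′`
at `α₄ = 8B₀′·5dLB₀·(α₀ + α₁)`, given the (1.36) exponent `A` of `U′` — `B8Thm2TorusServerP2.sockP5Base_of_lettersAt` VERBATIM with `hUq` replaced by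
the letters at truncation `1`, the free radius `α₄ᵘ` and the uniqueness windows at `2B₀` (`huniq_base_torus`).
[cite: Balaban1985RegularSpaces, Prop. 5 (1.106)–(1.109) p.94, p.89 (the start of the induction), (1.36) p.82, p.77, p.76] -/
theorem sockP5Base_of_lettersAt_u (hτ : ∀ x y : 𝔸, τ (x * y) = τ (y * x)) (hd2 : 2 ≤ d) {L : ℕ} (hL : 2 ≤ L) {η : ℝ} (hη : 0 < η) {k : ℕ}
    (hk : 1 ≤ k)
    {P : ℤ} (hP : ∃ M : ℤ, P = (L : ℤ) ^ k * M)
    {G H : Subgroup 𝔸ˣ} (hGrp2 : ∀ g ∈ H, ‖(g : 𝔸) - 1‖ ≤ 1 / 8 → τ (mlog (g : 𝔸)) = 0) (hGrp3 : ∀ S : 𝔸, τ S = 0 → expUnit S ∈ H)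
    (hGA : AvgClosed d L G) (hGH : G ≤ H) (hGu : G ≤ unitaryUnits 𝔸)
    (hG3 : ∀ (lam : Site d → 𝔸) (x : Site d), IsSelfAdjoint (lam x) → τ (lam x) = 0 → gaugeExp lam x ∈ G)
    {α₀ α₁ B₀ B₀' B₀'H B₂' BG BR B₀β cB9 cB β cu α₄u : ℝ} {len : Site d → ℝ} (hα₀ : 0 < α₀) (hα₁ : 0 < α₁)
    (hB₀ : 0 < B₀) (hB₀' : 0 < B₀') (hB₀'H : 0 < B₀'H) (hB₂' : 0 ≤ B₂') (hBG : 0 ≤ BG) (hBR : 0 ≤ BR) (hα₄u : 0 < α₄u)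
    (hcu : 8 * B₀' * (5 * (d : ℝ) * L * B₀) * (α₀ + α₁) < cu)
    {U₀ U' : Site d → Fin d → 𝔸ˣ} (hU₀G : ∀ x κ, U₀ x κ ∈ G) (hU'G : ∀ x κ, U' x κ ∈ G)
    (hU₀P : ∀ (x : Site d) (i : Fin d), U₀ (x + P • e i) = U₀ x) (hU'P : ∀ (x : Site d) (i : Fin d), U' (x + P • e i) = U' x)
    (h33 : InAk L k η α₀ (fun _ => (Set.univ : Set (Site d))) U₀) (h34 : InAk L k η α₀ (fun _ => (Set.univ : Set (Site d))) (mulCfg U' U₀))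
    (hAx : ∀ m', m' ≤ k → InAx L m' (torusLam (d := d) m') U₀ (mulCfg U' U₀))
    (ℓ : LettersAt (𝔸 := 𝔸) L BG BR B₀'H B₂' B₀ B₀β cB β len η k α₀ U₀) (ℓτ : LettersTau (𝔸 := 𝔸) τ ℓ)
    (ℓ₁ : LettersAt (𝔸 := 𝔸) L BG BR B₀'H B₂' B₀ B₀β cB β len η 1 α₀ U₀)
    (hwin : ∀ cs α₄ cB cDA hE hE₂ lE lE₂ : ℝ, cs = 5 * (d : ℝ) * L * B₀ * (α₀ + α₁) → α₄ = 8 * B₀' * (5 * (d : ℝ) * L * B₀) * (α₀ + α₁) →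
      cB = L * cs → cDA = 2 * (d : ℝ) * (L : ℝ) ^ 2 * cs →
      hE = B₀'H * (C2p d * (40 * d * cB + α₄) * α₄) → hE₂ = B₂' * (C2p d * (40 * d * cB + α₄) * α₄) →
      lE = B₀'H * (4 * C2p d * (40 * d * cB + 2 * α₄)) → lE₂ = B₂' * (4 * C2p d * (40 * d * cB + 2 * α₄)) →
      36 * d * B₀ * cs ≤ 1 / 2 ∧
      8 * (131072 * ((d : ℝ) + 1) ^ 2) * Real.exp (4 * (800 * ((d : ℝ) + 1) ^ 2 * ((d : ℝ) + 4)) * α₀) ≤ 16 * (131072 * ((d : ℝ) + 1) ^ 2) ∧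
      2 * cs ^ 2 + 20 * d * α₀ * cs + 2 * (16 * (131072 * ((d : ℝ) + 1) ^ 2)) * cs ^ 2 ≤ α₀ + α₁ ∧
      (d : ℝ) * L * α₁ ≤ 1 / 8 ∧
      α₀ ≤ cB9 ∧ cs ≤ cB9 ∧
      C0 d * α₀ ≤ 1 / 3 ∧ 4 * α₀ ≤ c2' d L ∧
      Real.exp (4 * (800 * ((d : ℝ) + 1) ^ 2 * ((d : ℝ) + 4)) * α₀) * (1 + 8 * (131072 * ((d : ℝ) + 1) ^ 2) * cB) ≤ 2 ∧
      2 * cB ≤ c3 d L ∧ 2048 * (d : ℝ) * cB ≤ 1 ∧ 40 * d * cB ≤ 1 / 200 ∧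
      200 * C6 d * (2 * α₄) ≤ 1 ∧ 12000 * ((d : ℝ) + 1) * L * (2 * α₄) ≤ 1 ∧
      C4G d L * (α₀ + 40 * d * cB + 4 * (2 * α₄)) ≤ 1 ∧
      1024 * ((d : ℝ) + 1) * ((d : ℝ) + 4) * L ^ 2 * α₀ ≤ 1 ∧ 32 * ((d : ℝ) + 1) ^ 2 * C6 d * L ^ 2 * α₀ ≤ 1 ∧
      16 * d * C5' d * C6 d * (L : ℝ) ^ 2 * α₀ ≤ 1 ∧ 8 * d * C6 d * L * α₀ ≤ 1 ∧
      40 * d * cB + α₄ ≤ 1 / (4 * B₀'H * (2 * C2p d)) ∧ 2 * C6 d * (40 * d * cB + 4 * α₄) ≤ 1 / 8 ∧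
      cB ≤ 1 / 13 ∧ α₄ / 4 + hE ≤ 1 / 24 ∧ α₄ / 4 + hE ≤ 1 / 140 ∧ 10 * (α₄ / 4 + hE) * BR ≤ 1 / 2 ∧
      BG * Mc d BR (α₄ / 4 + hE) cB hE₂ cDA ≤ α₄ / 4 ∧
      BG * Kc d BR (α₄ / 4 + hE) cB hE₂ cDA lE₂ (1 + lE) (1 + lE) ≤ 1 / 2)
    (huw : ∀ cs cB cDA hE hE₂ lE lE₂ : ℝ, cs = 5 * (d : ℝ) * L * (2 * B₀) * (α₀ + α₁) → cB = L * cs → cDA = (d : ℝ) * (L : ℝ) ^ 2 * cs →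
      hE = B₀'H * (C2p d * (40 * d * cB + α₄u) * α₄u) → hE₂ = B₂' * (C2p d * (40 * d * cB + α₄u) * α₄u) →
      lE = B₀'H * (4 * C2p d * (40 * d * cB + 2 * α₄u)) → lE₂ = B₂' * (4 * C2p d * (40 * d * cB + 2 * α₄u)) →
      36 * d * (2 * B₀) * cs ≤ 1 / 2 ∧
      8 * (131072 * ((d : ℝ) + 1) ^ 2) * Real.exp (4 * (800 * ((d : ℝ) + 1) ^ 2 * ((d : ℝ) + 4)) * α₀) ≤ 16 * (131072 * ((d : ℝ) + 1) ^ 2) ∧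
      2 * cs ^ 2 + 20 * d * α₀ * cs + 2 * (16 * (131072 * ((d : ℝ) + 1) ^ 2)) * cs ^ 2 ≤ α₀ + α₁ ∧
      (d : ℝ) * L * α₁ ≤ 1 / 8 ∧
      α₀ ≤ cB9 ∧ cs ≤ cB9 ∧
      C0 d * α₀ ≤ 1 / 3 ∧ 4 * α₀ ≤ c2' d L ∧
      Real.exp (4 * (800 * ((d : ℝ) + 1) ^ 2 * ((d : ℝ) + 4)) * α₀) * (1 + 8 * (131072 * ((d : ℝ) + 1) ^ 2) * cB) ≤ 2 ∧
      2 * cB ≤ c3 d L ∧ 2048 * (d : ℝ) * cB ≤ 1 ∧ 40 * d * cB ≤ 1 / 200 ∧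
      200 * C6 d * (2 * α₄u) ≤ 1 ∧ 12000 * ((d : ℝ) + 1) * L * (2 * α₄u) ≤ 1 ∧
      C4G d L * (α₀ + 40 * d * cB + 4 * (2 * α₄u)) ≤ 1 ∧
      1024 * ((d : ℝ) + 1) * ((d : ℝ) + 4) * L ^ 2 * α₀ ≤ 1 ∧ 32 * ((d : ℝ) + 1) ^ 2 * C6 d * L ^ 2 * α₀ ≤ 1 ∧
      16 * d * C5' d * C6 d * (L : ℝ) ^ 2 * α₀ ≤ 1 ∧ 8 * d * C6 d * L * α₀ ≤ 1 ∧
      40 * d * cB + α₄u ≤ 1 / (4 * B₀'H * (2 * C2p d)) ∧ 2 * C6 d * (40 * d * cB + 4 * α₄u) ≤ 1 / 8 ∧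
      cB ≤ 1 / 13 ∧ α₄u / 4 + hE ≤ 1 / 24 ∧ α₄u / 4 + hE ≤ 1 / 140 ∧ 10 * (α₄u / 4 + hE) * BR ≤ 1 / 2 ∧
      BG * Mc d BR (α₄u / 4 + hE) cB hE₂ cDA ≤ α₄u / 4 ∧
      BG * Kc d BR (α₄u / 4 + hE) cB hE₂ cDA lE₂ (1 + lE) (1 + lE) ≤ 1 / 2 ∧
      lE ≤ 1 / 2 ∧ cu + hE ≤ α₄u / 4)
    {A : Site d → Fin d → 𝔸}
    (hdat : ∀ (x : Site d) (κ : Fin d), U' x κ = cfgExp η A x κ ∧ IsSelfAdjoint (A x κ) ∧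
      ‖A x κ‖ ≤ (5 * (d : ℝ) * L * B₀ * (α₀ + α₁)) * ((L : ℝ) ^ 0 * η)⁻¹) :
    SockP5Base (𝔸 := 𝔸) L P η (8 * B₀' * (5 * (d : ℝ) * L * B₀) * (α₀ + α₁)) G U₀ U' := by
  have hL1 : 1 ≤ L := le_trans (by norm_num) hL
  have hLr : (1 : ℝ) ≤ L := by exact_mod_cast hL1
  have hU₀ : ∀ x κ, U₀ x κ ∈ unitaryUnits 𝔸 := fun x κ => hGu (hU₀G x κ)
  -- two of the windows: `α₄ ≤ 1/84` and `c⋆ ≤ 1/12`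
  obtain ⟨-, -, -, -, -, -, -, -, -, -, -, hα₃', hs₁, -⟩ := hwin _ _ _ _ _ _ _ _ rfl rfl rfl rfl rfl rfl rfl rfl
  have hsum : 0 ≤ α₀ + α₁ := by linarith
  have hcs0 : 0 ≤ 5 * (d : ℝ) * L * B₀ * (α₀ + α₁) := by positivity
  have hC6 : (2 : ℝ) ≤ C6 d := by unfold C6; linarith [one_le_C5 (d := d)]
  have hα84 : 8 * B₀' * (5 * (d : ℝ) * L * B₀) * (α₀ + α₁) ≤ 1 / 84 := by
    have h0 : 0 ≤ 8 * B₀' * (5 * (d : ℝ) * L * B₀) * (α₀ + α₁) := by positivity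
    nlinarith [hs₁, hC6, h0]
  have hcs12 : 5 * (d : ℝ) * L * B₀ * (α₀ + α₁) ≤ 1 / 12 := by
    have hd0 : (1 : ℝ) ≤ d := by exact_mod_cast (show 1 ≤ d by omega)
    have hcsB : 5 * (d : ℝ) * L * B₀ * (α₀ + α₁) ≤ L * (5 * (d : ℝ) * L * B₀ * (α₀ + α₁)) := le_mul_of_one_le_left hcs0 hLr
    have hcBsmall : (d : ℝ) * (L * (5 * (d : ℝ) * L * B₀ * (α₀ + α₁))) ≤ 1 / 8000 := by linarith only [hα₃']
    have h1 : 5 * (d : ℝ) * L * B₀ * (α₀ + α₁) ≤ 1 / 8000 :=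
      ((le_mul_of_one_le_left hcs0 hd0).trans (mul_le_mul_of_nonneg_left hcsB (by positivity))).trans hcBsmall
    linarith only [h1]
  -- the datum's (1.36) on the bonds touching `T_η` at `j ≤ 0`
  have hdat' : ∀ j, j ≤ 0 → ∀ b ∈ {b : Site d × Fin d | SideTouches ((fun _ => (Set.univ : Set (Site d))) j) b.1 b.2},
      U' b.1 b.2 = cfgExp η A b.1 b.2 ∧ IsSelfAdjoint (A b.1 b.2) ∧ ‖A b.1 b.2‖ ≤ (5 * (d : ℝ) * L * B₀ * (α₀ + α₁)) * ((L : ℝ) ^ j * η)⁻¹ := by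
    intro j hj b _
    have hj0 : j = 0 := Nat.le_zero.1 hj
    subst hj0
    exact hdat b.1 b.2
  -- the `τ`-free ∃λ-body at the base datum
  have hbody := sockHFP₀τ_family_of_lettersAt τ hτ hd2 hL hη hk hGrp2 hGrp3 hGA hGH hGu hα₀ hα₁ hB₀ hB₀' hB₀'H hB₂' hBG hBR hU₀G hU'G h33 h34
    hAx ℓ ℓτ hwin A hdat'
  have hP' : ∃ c : ℤ, P = (L : ℤ) * c := by
    obtain ⟨M, hM⟩ := hP
    refine ⟨(L : ℤ) ^ (k - 1) * M, ?_⟩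
    rw [hM, ← mul_assoc, ← pow_succ', Nat.sub_add_cancel hk]
  -- print's «exactly one λ» at the base datum, from the letters at truncation `1`
  have huniq := fun (v w : Site d → 𝔸ˣ) (lam mu : Site d → 𝔸) hv hvD hw hwD hLv hRv hLw hRw =>
    huniq_base_torus k hd2 hL hη hk hα₀ hα₁ hB₀ hα₄u hU₀ h33 h34 hAx hdat hB₀'H hB₂' hBG hBR ℓ₁ (cB9 := cB9) huw (v := v) (w := w)
      (lam := lam) (mu := mu) hv hvD hw hwD hLv hRv hLw hRw
  exact sockP5Base_body_of_traceFree hd2 hη hL1 hP' τ hG3 hU₀ hU₀P hU'P hα84 hcs12 hcu hdat hbody huniq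

end Step

/-! ## §3 Route P's Theorem-2-level uniqueness socket `SockP5Uniq` at `c_A = 5dLB₀(α₀ + α₁′)`, from the letters at the top truncation -/

section Top

omit [Nontrivial 𝔸] in
/-- `(1/iη) log e^{iηA} = A` bondwise reading at the top weight (`B8Thm2TorusSupplier.logCfg_cfgExp_eq`), restated for the datum of `SockP5Uniq`.
[cite: Balaban1985RegularSpaces, (1.36) p.82, (1.38) p.82] -/
private theorem logCfg_cfgExp_eq' {η : ℝ} (hη : 0 < η) {L : ℕ} (hL1 : 1 ≤ L) (k : ℕ) {c : ℝ} (hc : 0 ≤ c) (hc16 : 16 * c ≤ 1)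
    {A : Site d → Fin d → 𝔸} (hA : ∀ (x : Site d) (κ : Fin d), ‖A x κ‖ ≤ c * ((L : ℝ) ^ k * η)⁻¹) :
    B8Eq138LandauZd.logCfg η (cfgExp η A) = A :=
  B8Thm2TorusSupplier.logCfg_cfgExp_eq hη hL1 k hc hc16 hA

/-- ★ **ROUTE P's THEOREM-2-LEVEL UNIQUENESS SOCKET `SockP5Uniq` FROM THE LETTERS AT THE TOP TRUNCATION** (p. 94 «such a configuration u′ is unique»,
used on p. 95): for a `G`-valued pair (`G ≤ U(𝔸)`) in Theorem 2's regime on `T_η` whose all-levels closeness (1.66) is `≤ α₁′`, the letters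
`LettersAt … k α₀ U₀`, the b9 socket at the top truncation and the uniqueness windows at `(α₀, α₁′)` (instance `2B₀`, radius `α₄ᵘ`, domain `c_u`):
`B8Thm2TorusSupplier.SockP5Uniq L k P η c_A c_u G U₀ U′` at `c_A = 5dLB₀(α₀ + α₁′)` — `B8SockP5uEAssemblyB.sockP5uE_body_of_join_b` at `Ω_j = T_η`,
`Λ_j = torusLam` (the datum's `U₁ = U′^{u₁⁻¹} = e^{iηA₁}`, its Landau letter that of `A₁`, the level-`k` gradient clause serving every `j ≤ k`).
[cite: Balaban1985RegularSpaces, Prop. 5 (1.109) p.94, p.95 (after (1.112)), (1.36) p.82, p.77; Balaban1985BackgroundPropagators, Thm 3.1 p.397] -/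
theorem sockP5Uniq_of_lettersAt (hd2 : 2 ≤ d) {L : ℕ} (hL : 2 ≤ L) {η : ℝ} (hη : 0 < η) {k : ℕ} (hk : 1 ≤ k) {P : ℤ}
    {G : Subgroup 𝔸ˣ} (hGu : G ≤ unitaryUnits 𝔸) {B₀ α₀ α₁' α₄u cu : ℝ} (hα₀ : 0 < α₀) (hα₁' : 0 < α₁') (hB₀ : 0 < B₀)
    (hα₄u : 0 < α₄u)
    {U₀ U' : Site d → Fin d → 𝔸ˣ} (hU₀G : ∀ x κ, U₀ x κ ∈ G) (hU'G : ∀ x κ, U' x κ ∈ G)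
    (h33 : InAk L k η α₀ (fun _ => (Set.univ : Set (Site d))) U₀) (h34 : InAk L k η α₀ (fun _ => (Set.univ : Set (Site d))) (mulCfg U' U₀))
    (hAx : ∀ m', m' ≤ k → InAx L m' (torusLam (d := d) m') U₀ (mulCfg U' U₀))
    (h135 : ∀ j, j ≤ k → ∀ (z : Site d) (μ : Fin d), (∀ x, InBox (loK L j z) (bondHiK L j z μ) x → x ∈ (fun _ => (Set.univ : Set (Site d))) j) →
      ‖(avgIter L (mulCfg U' U₀) j z μ : 𝔸) - (avgIter L U₀ j z μ : 𝔸)‖ ≤ α₁')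
    {B₀β cB9 β : ℝ} {len : Site d → ℝ}
    (SB9 : SockB9P3 (𝔸 := 𝔸) L B₀ B₀β cB9 β len η k (fun _ => (Set.univ : Set (Site d))) (fun m' => torusLam (d := d) m')
      (fun m' => torusLamb (d := d) m'))
    {BG BR B₀'H B₂' B₀ℓ B₀βℓ cBℓ βℓ : ℝ} {lenℓ : Site d → ℝ} (hB₀'H : 0 < B₀'H) (hB₂' : 0 ≤ B₂') (hBG : 0 ≤ BG) (hBR : 0 ≤ BR)
    (ℓ : LettersAt (𝔸 := 𝔸) L BG BR B₀'H B₂' B₀ℓ B₀βℓ cBℓ βℓ lenℓ η k α₀ U₀)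
    (huw : ∀ cs cB cDA hE hE₂ lE lE₂ : ℝ, cs = 5 * (d : ℝ) * L * (2 * B₀) * (α₀ + α₁') → cB = L * cs → cDA = (d : ℝ) * (L : ℝ) ^ 2 * cs →
      hE = B₀'H * (C2p d * (40 * d * cB + α₄u) * α₄u) → hE₂ = B₂' * (C2p d * (40 * d * cB + α₄u) * α₄u) →
      lE = B₀'H * (4 * C2p d * (40 * d * cB + 2 * α₄u)) → lE₂ = B₂' * (4 * C2p d * (40 * d * cB + 2 * α₄u)) →
      36 * d * (2 * B₀) * cs ≤ 1 / 2 ∧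
      8 * (131072 * ((d : ℝ) + 1) ^ 2) * Real.exp (4 * (800 * ((d : ℝ) + 1) ^ 2 * ((d : ℝ) + 4)) * α₀) ≤ 16 * (131072 * ((d : ℝ) + 1) ^ 2) ∧
      2 * cs ^ 2 + 20 * d * α₀ * cs + 2 * (16 * (131072 * ((d : ℝ) + 1) ^ 2)) * cs ^ 2 ≤ α₀ + α₁' ∧
      (d : ℝ) * L * α₁' ≤ 1 / 8 ∧
      α₀ ≤ cB9 ∧ cs ≤ cB9 ∧
      C0 d * α₀ ≤ 1 / 3 ∧ 4 * α₀ ≤ c2' d L ∧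
      Real.exp (4 * (800 * ((d : ℝ) + 1) ^ 2 * ((d : ℝ) + 4)) * α₀) * (1 + 8 * (131072 * ((d : ℝ) + 1) ^ 2) * cB) ≤ 2 ∧
      2 * cB ≤ c3 d L ∧ 2048 * (d : ℝ) * cB ≤ 1 ∧ 40 * d * cB ≤ 1 / 200 ∧
      200 * C6 d * (2 * α₄u) ≤ 1 ∧ 12000 * ((d : ℝ) + 1) * L * (2 * α₄u) ≤ 1 ∧
      C4G d L * (α₀ + 40 * d * cB + 4 * (2 * α₄u)) ≤ 1 ∧
      1024 * ((d : ℝ) + 1) * ((d : ℝ) + 4) * L ^ 2 * α₀ ≤ 1 ∧ 32 * ((d : ℝ) + 1) ^ 2 * C6 d * L ^ 2 * α₀ ≤ 1 ∧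
      16 * d * C5' d * C6 d * (L : ℝ) ^ 2 * α₀ ≤ 1 ∧ 8 * d * C6 d * L * α₀ ≤ 1 ∧
      40 * d * cB + α₄u ≤ 1 / (4 * B₀'H * (2 * C2p d)) ∧ 2 * C6 d * (40 * d * cB + 4 * α₄u) ≤ 1 / 8 ∧
      cB ≤ 1 / 13 ∧ α₄u / 4 + hE ≤ 1 / 24 ∧ α₄u / 4 + hE ≤ 1 / 140 ∧ 10 * (α₄u / 4 + hE) * BR ≤ 1 / 2 ∧
      BG * Mc d BR (α₄u / 4 + hE) cB hE₂ cDA ≤ α₄u / 4 ∧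
      BG * Kc d BR (α₄u / 4 + hE) cB hE₂ cDA lE₂ (1 + lE) (1 + lE) ≤ 1 / 2 ∧
      lE ≤ 1 / 2 ∧ cu + hE ≤ α₄u / 4) :
    SockP5Uniq (𝔸 := 𝔸) L k P η (5 * (d : ℝ) * L * B₀ * (α₀ + α₁')) cu G U₀ U' := by
  intro u₁ A₁ hu₁G _ h129 hW hsa hbd hLan v w lam mu _ _ _ _ hv hw hLv h129v hLw h129w
  have hL1 : 1 ≤ L := le_trans (by norm_num) hL
  have hLr : (1 : ℝ) ≤ L := by exact_mod_cast hL1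
  have hU₀ : ∀ x κ, U₀ x κ ∈ unitaryUnits 𝔸 := fun x κ => hGu (hU₀G x κ)
  have hU' : ∀ x κ, U' x κ ∈ unitaryUnits 𝔸 := fun x κ => hGu (hU'G x κ)
  have hu₁ : ∀ x, u₁ x ∈ unitaryUnits 𝔸 := fun x => hGu (hu₁G x)
  obtain ⟨hΩ, hΩ0, htw, -, -⟩ := torus_member_laws (d := d) hL k
  -- the windows at `(α₀, α₁′)`, instance `2B₀`
  obtain ⟨hside2, hC₂, h61₂, hsmall₁, hα₀9, hcs9₂, hα3, hα4, hsmall, hc₃, hsc, hα₃', hs₁, hs₂, hs₃, hs₄, hs₅, hs₆, hs₇, hsm, hprod8, hcA', ha₁',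
    hb₁', hθ, h103, h106, hlE, hcu⟩ := huw _ _ _ _ _ _ _ rfl rfl rfl rfl rfl rfl rfl
  have hsum : 0 ≤ α₀ + α₁' := by linarith
  have hcA0 : 0 ≤ 5 * (d : ℝ) * L * B₀ * (α₀ + α₁') := by positivity
  have hcs2 : 5 * (d : ℝ) * L * (2 * B₀) * (α₀ + α₁') = 2 * (5 * (d : ℝ) * L * B₀ * (α₀ + α₁')) := by ring
  have h12 : 5 * (d : ℝ) * L * B₀ * (α₀ + α₁') ≤ 5 * (d : ℝ) * L * (2 * B₀) * (α₀ + α₁') := by rw [hcs2]; linarith only [hcA0]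
  have hcBlo : L * (5 * (d : ℝ) * L * B₀ * (α₀ + α₁')) ≤ L * (5 * (d : ℝ) * L * (2 * B₀) * (α₀ + α₁')) :=
    mul_le_mul_of_nonneg_left h12 (Nat.cast_nonneg L)
  have hcDAlo : (d : ℝ) * (L : ℝ) ^ 2 * (5 * (d : ℝ) * L * B₀ * (α₀ + α₁')) ≤
      (d : ℝ) * (L : ℝ) ^ 2 * (5 * (d : ℝ) * L * (2 * B₀) * (α₀ + α₁')) :=
    mul_le_mul_of_nonneg_left h12 (by positivity)
  have hside : 36 * d * B₀ * (5 * (d : ℝ) * L * B₀ * (α₀ + α₁')) ≤ 1 / 2 := by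
    have hB2 : 36 * (d : ℝ) * B₀ ≤ 36 * d * (2 * B₀) := by nlinarith only [hB₀.le, Nat.cast_nonneg (α := ℝ) d]
    exact (mul_le_mul hB2 h12 hcA0 (by positivity)).trans hside2
  have h61 : 2 * (5 * (d : ℝ) * L * B₀ * (α₀ + α₁')) ^ 2 + 20 * d * α₀ * (5 * (d : ℝ) * L * B₀ * (α₀ + α₁'))
      + 2 * (16 * (131072 * ((d : ℝ) + 1) ^ 2)) * (5 * (d : ℝ) * L * B₀ * (α₀ + α₁')) ^ 2 ≤ α₀ + α₁' := by
    have hsq : (5 * (d : ℝ) * L * B₀ * (α₀ + α₁')) ^ 2 ≤ (5 * (d : ℝ) * L * (2 * B₀) * (α₀ + α₁')) ^ 2 := pow_le_pow_left₀ hcA0 h12 2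
    have hlin : 20 * d * α₀ * (5 * (d : ℝ) * L * B₀ * (α₀ + α₁')) ≤ 20 * d * α₀ * (5 * (d : ℝ) * L * (2 * B₀) * (α₀ + α₁')) :=
      mul_le_mul_of_nonneg_left h12 (by positivity)
    have hsq2 : 2 * (16 * (131072 * ((d : ℝ) + 1) ^ 2)) * (5 * (d : ℝ) * L * B₀ * (α₀ + α₁')) ^ 2 ≤
        2 * (16 * (131072 * ((d : ℝ) + 1) ^ 2)) * (5 * (d : ℝ) * L * (2 * B₀) * (α₀ + α₁')) ^ 2 := mul_le_mul_of_nonneg_left hsq (by positivity)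
    linarith only [h61₂, hsq, hlin, hsq2]
  have hcs9 : 5 * (d : ℝ) * L * B₀ * (α₀ + α₁') ≤ cB9 := h12.trans hcs9₂
  -- `16 c_A ≤ 1` (from `40d·c_B ≤ 1/200`, `c_A ≤ L·(2c_A) = c_B`, `d ≥ 1`)
  have hcA16 : 16 * (5 * (d : ℝ) * L * B₀ * (α₀ + α₁')) ≤ 1 := by
    have hd0 : (1 : ℝ) ≤ d := by exact_mod_cast (show 1 ≤ d by omega)
    have hcsB : 5 * (d : ℝ) * L * B₀ * (α₀ + α₁') ≤ L * (5 * (d : ℝ) * L * (2 * B₀) * (α₀ + α₁')) :=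
      (le_mul_of_one_le_left hcA0 hLr).trans hcBlo
    have h1 : (d : ℝ) * (5 * (d : ℝ) * L * B₀ * (α₀ + α₁')) ≤ (d : ℝ) * (L * (5 * (d : ℝ) * L * (2 * B₀) * (α₀ + α₁'))) :=
      mul_le_mul_of_nonneg_left hcsB (by positivity)
    have h2 : 5 * (d : ℝ) * L * B₀ * (α₀ + α₁') ≤ (d : ℝ) * (5 * (d : ℝ) * L * B₀ * (α₀ + α₁')) := le_mul_of_one_le_left hcA0 hd0
    linarith only [hα₃', h1, h2]
  -- `U₁ = U′^{u₁⁻¹} = e^{iηA₁}` and its Landau letter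
  have hU₁ : mgauge U₀ u₁⁻¹ U' = cfgExp η A₁ := by rw [← hW]; exact B8Eq131Derivation.mgauge_inv_mgauge U₀ u₁ _
  have hlog : B8Eq138LandauZd.logCfg η (cfgExp η A₁) = A₁ := logCfg_cfgExp_eq' hη hL1 k hcA0 hcA16 hbd
  have hLanW : IsLandau138W L k η ((fun _ => (Set.univ : Set (Site d))) 0) ((fun m' => torusLam (d := d) m') k) U₀ (mgauge U₀ u₁⁻¹ U') := by
    rw [hU₁]
    show IsLandau138 L k η (Set.univ : Set (Site d)) (torusLam k) U₀ (B8Eq138LandauZd.logCfg η (cfgExp η A₁))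
    rw [hlog]; exact hLan
  -- (1.36) on the sides at every `j ≤ k` from the level-`k` bound
  have hA₁ : ∃ A : Site d → Fin d → 𝔸, ∀ j, j ≤ k → ∀ (x : Site d) (κ : Fin d), SideTouches ((fun _ => (Set.univ : Set (Site d))) j) x κ →
      mgauge U₀ u₁⁻¹ U' x κ = cfgExp η A x κ ∧ ‖A x κ‖ ≤ (5 * (d : ℝ) * L * B₀ * (α₀ + α₁')) * ((L : ℝ) ^ j * η)⁻¹ := by
    refine ⟨A₁, fun j hj x κ _ => ⟨by rw [hU₁], (hbd x κ).trans (mul_le_mul_of_nonneg_left ?_ hcA0)⟩⟩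
    rw [mul_inv, mul_inv]
    exact mul_le_mul_of_nonneg_right (inv_anti₀ (by positivity) (pow_le_pow_right₀ hLr hj)) (by positivity)
  -- the competitors' clauses in the JOIN's shape
  have hgrad : ∀ {l : Site d → 𝔸}, (∀ (x : Site d) (κ : Fin d), ((L : ℝ) ^ k * η) * ‖covDerivFwd η U₀ κ l x‖ < cu) →
      ∀ j, j ≤ k → ∀ b ∈ {b : Site d × Fin d | SideTouches ((fun _ => (Set.univ : Set (Site d))) j) b.1 b.2},
        ((L : ℝ) ^ j * η) * ‖covDerivFwd η U₀ b.2 l b.1‖ < cu := by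
    intro l hl j hj b _
    refine lt_of_le_of_lt ?_ (hl b.1 b.2)
    exact mul_le_mul_of_nonneg_right (mul_le_mul_of_nonneg_right (pow_le_pow_right₀ hLr hj) hη.le) (norm_nonneg _)
  have heq := sockP5uE_body_of_join_b hd2 hL hη hk (Ω := fun _ => (Set.univ : Set (Site d))) hΩ hΩ0
    (Λs := fun m' => torusLam (d := d) m') (Λb := fun m' => torusLamb (d := d) m') (fun _ _ _ _ _ _ _ _ => Set.mem_univ _) (torus_hclass k)
    (htw k le_rfl) hα₀ hα₁' hB₀ rfl hα₄u hU₀ hU' h33 h34 hAx h135 hu₁ h129 hLanW hA₁ SB9 hα₀9 hcs9 hside hC₂ h61 hsmall₁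
    (ℓ.Gp k) (ℓ.lapU k) (ℓ.Qp k) (ℓ.QpT k) (ℓ.Aw k) (ℓ.Cinv k) (ℓ.gp_left_bdd hk) (ℓ.cinv_range' hk) (ℓ.lapU_reads k hk le_rfl)
    (ℓ.qpT_reads k hk le_rfl) (ℓ.qp_reads k hk le_rfl) (ℓ.qp_zero_off hk) (ℓ.Hp k) hB₀'H hB₂' hBG hBR (ℓ.hp_sup k hk le_rfl)
    (ℓ.hp_grad k hk le_rfl) (ℓ.hp_lap k hk le_rfl) (ℓ.qp_hp k hk le_rfl) (ℓ.gp_sup_grad k hk le_rfl) (ℓ.r_bound k hk le_rfl) hcBlo hcBlo hcDAlo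
    hα3 hα4 hsmall hc₃ hsc hα₃' hs₁ hs₂ hs₃ hs₄ hs₅ hs₆ hs₇ hsm hprod8 rfl rfl rfl rfl hcA' ha₁' hb₁' hθ h103 h106 hlE hcu
    (v := v) (w := w) (lam := lam) (mu := mu) (fun x => ⟨(hv x).1, (hv x).2.1, (hv x).2.2.1⟩) (hgrad fun x κ => (hv x).2.2.2 κ)
    (fun x => ⟨(hw x).1, (hw x).2.1, (hw x).2.2.1⟩) (hgrad fun x κ => (hw x).2.2.2 κ) (by rw [hU₁]; exact hLv) h129v (by rw [hU₁]; exact hLw)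
    h129w
  exact funext heq

end Top

#print axioms huniq_step_torus
#print axioms huniq_base_torus
#print axioms sockP5Step_of_lettersAt_u
#print axioms sockP5Base_of_lettersAt_u
#print axioms sockP5Uniq_of_lettersAt

end Literature.MathematicalPhysics.QuantumFieldTheory.Balaban1983to89.B8Thm2TorusServerP3

end
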